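import Summits.Parity.GeneralizedHardyLittlewood.Theorems.LeeYangFibresCellParityLawSavingEngineDefs
import Summits.Parity.GeneralizedHardyLittlewood.Theorems.LeeYangFibresCellParityLawMertensTwo
import Summits.Parity.GeneralizedHardyLittlewood.Theorems.LeeYangFibresCellParityLawMainTerm
import Summits.Parity.GeneralizedHardyLittlewood.Theorems.LeeYangFibresCellParityLawAlladi
import Summits.Parity.GeneralizedHardyLittlewood.Theorems.LeeYangFibresCellParityLawSavingDensityAlong
import Summits.Parity.BatemanHorn.Theorems.RoughParitySectorsOddSectorShareNonlinearOddBuchstabMass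
import HarnessLib

/-!
# Route `LeeYangFibres`, crux `CellParityLawSaving` (stmt-Parity-18104), line `superpoly-band-same-atom`
# (payload slug `SketchIdeator3`): the registered stub `stub_mainTermAlong` — two-sided Mertens at
# `N^{1/U(N)}` and the main-term conversion ALONG THE SCHEDULE

We prove `MainTermAlong : SectionMertensLowerHead → MainTermConversionAlong` (vocabulary file
`LeeYangFibresCellParityLawSavingEngineDefs`): along the schedule `u = U = U(N) = slowDegree N`, in the
non-degenerate case, for every `ε > 0` and `N ≥ N₀(t, L, ε)`: (a) `e^γ V(N^{1/U}) ≤ H (log N)^ε/log N`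
(`V(z) = ∏_{p<z} (1 - g(p))`, `H = H_{Ψ,i} = sectionH Ψ i`), and (b) for `δ' ∈ [0,2]`, `m ≥ 1`, `F' ≥ 0`,
`|w (I_m(u')/u') e^γ V F' − w a_m H F'| ≤ H F' (log N)^ε/log² N` (`w = 1 + (δ'-1)(-1)^m`,
`u' = log(2LN)/log N^{1/U} = U + U log(2L)/log N`, `I_m = roughCellDensity m`, `a_m = modelDensity N U m`).
It is the sister crux's `stub_sectionMertensTwo` + `stub_geThreeMainTerm` (fixed `u`) run along the schedule:

1. `mertensTwo_explicit` — the sister's two-sided Mertens evaluation re-proved POINTWISE with its explicit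
   constant and thresholds: `|e^γ V(N^{1/u}) − u H/log N| ≤ u (C₁ + 32t + 50u) H/log² N` whenever `N ≥ N₁`
   (lower-head threshold), `L + 18t + 50u + 3 ≤ log N`, `log² N ≤ N^{1/u}` (proof verbatim: Mertens' product
   with rate `Π(z) = e^a (log z) e^γ`, `|a| ≤ 25u/log N`; the head `∏_{p<m} E_p`, `m = ⌈z⌉ ≥ log² N`, pinched
   between `H (1 − C₁ log N/m)` (the hypothesis) and `H (1 + 16t/m)` (`MertensAux.head_le`)).
2. `alladi_along` — `|a_m − I_m(U)/log N| ≤ 3 A^{2U} U²/log² N` for `U ≥ 4`, `N ≥ 16`, `U² ≤ log N`, `m ≥ 1`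
   (`anatomyAlong_bridge` fed with `anatomyAlong_explicitCellRate`, `a_m = A_m(N)/N`, the dictionary
   `cellDensity (m−1) U = I_m(U)`; the top cells `m > U` vanish on both sides).
3. Along the schedule (`quantClip_schedule`: `exp(4U²) ≤ log N ≤ exp((2U+2)²)`, `U ≥ U₀`) the thresholds
   hold (`thresholds`: `log N ≥ (1 + 2U²)² ≥ 51U, U², U log(2L), 2U log log N`); the sister's four-term bound
   `GeThreeMainTermAux.core_bound` (`C₁ := U(C₁ + 32t + 50U)`, `C₂ := 3A^{2U}U²`, the `1`-Lipschitz bound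
   `ModelDensityAlladiAux.abs_sub_le`, `0 ≤ I_m(U) ≤ U`) has constants `U + C₁, 2K ≤ c A^{2U} U⁴`
   (`bookkeeping`), and `c A^{2U} U⁴ ≤ c U^{U+4} ≤ exp(4εU²) ≤ (log N)^ε` for `U ≥ max(U₁(ε,c), A²)`
   (`const_le_exp`, by `quantClip_powSelf_le_exp`).

References: E. Bombieri, *The asymptotic sieve*, Rend. Accad. Naz. XL (5) 1/2 (1975/76) 243–269
[BombieriAsymptoticSieve1976]; K. Alladi, Quart. J. Math. Oxford (2) 33 (1982) 129–148 [Alladi1982];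
G. H. Hardy, E. M. Wright, Thm 429 (Mertens) [HardyWright2008]. No named fact is used: everything is
composed from landed tree theorems.
-/

noncomputable section

open scoped BigOperators Classical
open Finset Filter Literature.NumberTheory.Sieve
open Summit.Parity.GeneralizedHardyLittlewood.Cruxes.CellParityLaw.SectionAnnihilator
open Summit.Parity.GeneralizedHardyLittlewood.Cruxes.AbsoluteUpgrade.DipMarginRateExchange (slowDegree
  four_le_slowDegree quantClip_schedule quantClip_powSelf_le_exp anatomyAlong_bridge
  anatomyAlong_explicitCellRate)
open Summit.Parity.GeneralizedHardyLittlewood.Cruxes.ModelHyperbolicity.WindowChainTransport (cellDensity)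
open Summit.Parity.BatemanHorn.Cruxes.OddSectorShareNonlinear.Birth
  (oddMass_cellDensity_eq_roughCellDensity_succ)

namespace Summit.Parity.GeneralizedHardyLittlewood.Cruxes.CellParityLawSaving.SuperPolyBand

namespace MainTermAlongAux

/-! ## Step 1: two-sided Mertens at `z = N^{1/u}` with explicit constant and thresholds -/

/-- **Two-sided sharp Mertens at the cell threshold, pointwise with explicit constant** (the sister's
`stub_sectionMertensTwo` with its `Filter.atTop` thresholds turned into hypotheses): given the lower head
bound with constant `C₁ ≥ 0` beyond `N₁`, for `u ≥ 1` and `N ≥ max(N₁, 1)` with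
`L + 18t + 50u + 3 ≤ log N` and `log² N ≤ N^{1/u}`, in the non-degenerate case
`|e^γ ∏_{p<N^{1/u}} (1 − g(p)) − u H/log N| ≤ u (C₁ + 32t + 50u) H/log² N`. -/
theorem mertensTwo_explicit {t L N₁ : ℕ} {C₁ : ℝ} (hC₁ : 0 ≤ C₁)
    (hN₁ : ∀ N : ℕ, N₁ ≤ N → ∀ Ψ : Fin (t + 1) → AffLinForm 1, IsNondegenerateSystem Ψ →
      affLinSize Ψ N ≤ L → ∀ i : Fin (t + 1), (∀ p : ℕ, p.Prime → sectionDensity Ψ i p < 1) →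
      singularProduct (Fin.removeNth i Ψ) ≠ 0 → ∀ m : ℕ, L < m → 2 * t + 2 ≤ m →
        sectionH Ψ i * (1 - C₁ * Real.log N / m) ≤
          ∏ p ∈ Nat.primesBelow m, (1 - sectionDensity Ψ i p) / (1 - (p : ℝ)⁻¹))
    {u N : ℕ} (hu : 1 ≤ u) (hNN₁ : N₁ ≤ N) (hAN : (L : ℝ) + 18 * t + 50 * u + 3 ≤ Real.log N)
    (hsq : Real.log N ^ 2 ≤ zOf N u) (hN1 : 1 ≤ N)
    (Ψ : Fin (t + 1) → AffLinForm 1) (hΨ : IsNondegenerateSystem Ψ) (hL : affLinSize Ψ N ≤ L)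
    (i : Fin (t + 1)) (hg1 : ∀ p : ℕ, p.Prime → sectionDensity Ψ i p < 1)
    (hne : singularProduct (Fin.removeNth i Ψ) ≠ 0) :
    |Real.exp Real.eulerMascheroniConstant *
          ∏ p ∈ Nat.primesBelow ⌈zOf N u⌉₊, (1 - sectionDensity Ψ i p) -
        u * sectionH Ψ i / Real.log N| ≤
      u * (C₁ + 32 * t + 50 * u) * sectionH Ψ i / Real.log N ^ 2 := by
  have hu0 : (0 : ℝ) < u := by exact_mod_cast (show 0 < u by omega)
  have ht0 : (0 : ℝ) ≤ t := Nat.cast_nonneg t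
  have hL0 : (0 : ℝ) ≤ L := Nat.cast_nonneg L
  have hNr : (0 : ℝ) < N := by exact_mod_cast (show 0 < N by omega)
  have hℓ50 : 50 * (u : ℝ) ≤ Real.log N := by linarith
  have hℓ1 : 1 ≤ Real.log N := by linarith
  have hℓpos : 0 < Real.log N := by linarith
  have hH0 : 0 ≤ sectionH Ψ i := MertensAux.sectionH_nonneg Ψ hΨ i hne
  -- the threshold `z = N^{1/u}` and `m = ⌈z⌉ ≥ z ≥ log² N ≥ log N ≥ L + 18t + 50u + 3`
  set z : ℝ := zOf N u with hzdef
  have hℓsq : Real.log N ≤ Real.log N ^ 2 := by nlinarith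
  have hzA : (L : ℝ) + 18 * t + 50 * u + 3 ≤ z := hAN.trans (hℓsq.trans hsq)
  have hz2 : 2 ≤ z := by linarith
  have hlogz : Real.log z = Real.log N / u := by
    rw [hzdef, zOf, Real.log_rpow hNr]; ring
  have hzm : z ≤ (⌈z⌉₊ : ℕ) := Nat.le_ceil z
  have hmℓ2 : Real.log N ^ 2 ≤ (⌈z⌉₊ : ℕ) := hsq.trans hzm
  have hmℓ : Real.log N ≤ (⌈z⌉₊ : ℕ) := hℓsq.trans hmℓ2
  have hmA : (L : ℝ) + 18 * t + 50 * u + 3 ≤ ((⌈z⌉₊ : ℕ) : ℝ) := hzA.trans hzm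
  have hm0 : (0 : ℝ) < (⌈z⌉₊ : ℕ) := by linarith
  have hmL : L < ⌈z⌉₊ := by exact_mod_cast (show (L : ℝ) < (⌈z⌉₊ : ℕ) by linarith)
  have hmt : 2 * t + 2 ≤ ⌈z⌉₊ := by exact_mod_cast (show (2 * t + 2 : ℝ) ≤ (⌈z⌉₊ : ℕ) by linarith)
  have hm16 : 16 * t ≤ ⌈z⌉₊ := by exact_mod_cast (show (16 * t : ℝ) ≤ (⌈z⌉₊ : ℕ) by linarith)
  have hhead := MertensAux.head_le Ψ hΨ hL i hg1 hne hmL hmt hm16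
  have hlow := hN₁ N hNN₁ Ψ hΨ hL i hg1 hne ⌈z⌉₊ hmL hmt
  obtain ⟨a, ha, hPi⟩ := MertensTwoAux.mertensProd_eq_exp_mul hz2
  rw [hlogz, div_div_eq_mul_div] at ha
  have ha1 : |-a| ≤ 1 := by
    rw [abs_neg]; refine ha.trans ?_; rw [div_le_one hℓpos]; linarith
  have hF : |Real.exp (-a) - 1| ≤ 50 * u / Real.log N := by
    calc |Real.exp (-a) - 1| ≤ 2 * |-a| := Real.abs_exp_sub_one_le ha1
      _ = 2 * |a| := by rw [abs_neg]
      _ ≤ 2 * (25 * u / Real.log N) := by gcongr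
      _ = 50 * u / Real.log N := by ring
  have he1 : 50 * (u : ℝ) / Real.log N ≤ 1 := by rw [div_le_one hℓpos]; linarith
  -- `e^γ V(z) = (u/log N) · P e^{-a}`
  rw [MertensAux.prod_one_sub_eq Ψ i z, hPi]
  set P : ℝ := ∏ p ∈ Nat.primesBelow ⌈z⌉₊, (1 - sectionDensity Ψ i p) / (1 - (p : ℝ)⁻¹)
  have hP0 : 0 ≤ P := Finset.prod_nonneg fun p hp =>
    MertensAux.eulerFactor_nonneg Ψ i (Nat.prime_of_mem_primesBelow hp)
      (hg1 _ (Nat.prime_of_mem_primesBelow hp))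
  have hE : Real.exp Real.eulerMascheroniConstant *
        (P * (Real.exp a * Real.log z * Real.exp Real.eulerMascheroniConstant)⁻¹) -
      u * sectionH Ψ i / Real.log N =
      (u / Real.log N) * (P * Real.exp (-a) - sectionH Ψ i) := by
    have hℓne : Real.log (N : ℝ) ≠ 0 := hℓpos.ne'
    have hune : (u : ℝ) ≠ 0 := hu0.ne'
    rw [hlogz, Real.exp_neg]
    field_simp
  rw [hE, abs_mul, abs_of_pos (div_pos hu0 hℓpos)]
  have hkey := MertensTwoAux.abs_mul_sub_le hH0 hP0 (div_nonneg (by positivity) (Nat.cast_nonneg _))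
    (div_nonneg (mul_nonneg hC₁ hℓpos.le) (Nat.cast_nonneg _)) (div_nonneg (by positivity) hℓpos.le)
    he1 hhead hlow hF
  have ha' : 16 * (t : ℝ) / (⌈z⌉₊ : ℕ) ≤ 16 * t / Real.log N :=
    div_le_div_of_nonneg_left (by positivity) hℓpos hmℓ
  have hb' : C₁ * Real.log N / (⌈z⌉₊ : ℕ) ≤ C₁ / Real.log N := by
    rw [div_le_div_iff₀ hm0 hℓpos]
    nlinarith [mul_le_mul_of_nonneg_left hmℓ2 hC₁]
  have hsum : 2 * (16 * (t : ℝ) / (⌈z⌉₊ : ℕ)) + C₁ * Real.log N / (⌈z⌉₊ : ℕ) + 50 * u / Real.log N ≤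
      (C₁ + 32 * t + 50 * u) / Real.log N := by
    rw [show (C₁ + 32 * (t : ℝ) + 50 * u) / Real.log N =
      2 * (16 * (t : ℝ) / Real.log N) + C₁ / Real.log N + 50 * u / Real.log N by ring]
    linarith
  calc (u : ℝ) / Real.log N * |P * Real.exp (-a) - sectionH Ψ i|
      ≤ (u : ℝ) / Real.log N * (sectionH Ψ i * ((C₁ + 32 * t + 50 * u) / Real.log N)) :=
        mul_le_mul_of_nonneg_left (hkey.trans (mul_le_mul_of_nonneg_left hsum hH0))
          (div_pos hu0 hℓpos).le
    _ = u * (C₁ + 32 * t + 50 * u) * sectionH Ψ i / Real.log N ^ 2 := by ring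

/-! ## Step 2: Alladi along the schedule -/

/-- **Alladi's densities with rate along the schedule.** There is `A ≥ 2` (the constant of
`anatomyAlong_explicitCellRate`) such that for `U ≥ 4`, `N ≥ 16`, `U² ≤ log N` and every `m ≥ 1`:
`|a_m − I_m(U)/log N| ≤ 3 A^{2U} U²/log² N` (`a_m = modelDensity N U m = A_m(N)/N`, `I_m = roughCellDensity m`;
bulk cells `m ≤ U` by `anatomyAlong_bridge` and the dictionary `cellDensity (m−1) U = I_m(U)`, top cells `m > U`
vanish on both sides: `modelDensity_eq_zero`, `roughCellDensity_of_le`). -/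
theorem alladi_along : ∃ A : ℝ, 2 ≤ A ∧ ∀ {U N m : ℕ}, 4 ≤ U → 16 ≤ N → (U : ℝ) ^ 2 ≤ Real.log N →
    1 ≤ m → |modelDensity N U m - roughCellDensity m U / Real.log N| ≤
      3 * A ^ (2 * U) * (U : ℝ) ^ 2 / Real.log N ^ 2 := by
  obtain ⟨A, hA2, hrate⟩ := anatomyAlong_explicitCellRate
  refine ⟨A, hA2, fun {U N m} hU4 hN16 hU2 hm => ?_⟩
  have hA0 : 0 < A := by linarith
  have hN16r : (16 : ℝ) ≤ N := by exact_mod_cast hN16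
  have hNne : (N : ℝ) ≠ 0 := by positivity
  have hℓ : 0 < Real.log N := Real.log_pos (by linarith)
  have hℓne : Real.log N ≠ 0 := hℓ.ne'
  rcases le_or_gt m U with hmU | hUm
  · have h := anatomyAlong_bridge hA2 hrate hU4 hN16 hU2 hm hmU
    have hdict : cellDensity (m - 1) (U : ℝ) = roughCellDensity m U := by
      have h1 := oddMass_cellDensity_eq_roughCellDensity_succ (m - 1) (u := (U : ℝ))
        (by exact_mod_cast (show 1 ≤ U by omega))
      rwa [Nat.sub_add_cancel hm] at h1
    have heq : modelDensity N U m - roughCellDensity m U / Real.log N =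
        ((Summit.Parity.GeneralizedHardyLittlewood.Theorems.ModelHyperbolicity.Negative.cell U N m : ℝ) *
            Real.log N / N - cellDensity (m - 1) U) / Real.log N := by
      rw [hdict, DensityAlongAux.modelDensity_eq_cell_div]
      field_simp
    rw [heq, abs_div, abs_of_pos hℓ]
    calc _ ≤ 3 * A ^ (2 * U) * (U : ℝ) ^ 2 / Real.log N / Real.log N := div_le_div_of_nonneg_right h hℓ.le
      _ = 3 * A ^ (2 * U) * (U : ℝ) ^ 2 / Real.log N ^ 2 := by rw [div_div, ← pow_two]
  · have h1 : modelDensity N U m = 0 := modelDensity_eq_zero (by omega) hUm.le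
    have h2 : roughCellDensity m (U : ℝ) = 0 :=
      roughCellDensity_of_le (by omega) (by exact_mod_cast hUm.le)
    rw [h1, h2, zero_div, sub_zero, abs_zero]
    positivity

/-! ## Step 3: schedule numerics and the bookkeeping of the constants -/

/-- **`U^U` beats the constants.** For `ε > 0`, `c` and `A ≥ 1`: `c A^{2U} U⁴ ≤ exp(4εU²)` for all
`U ≥ U₀` (`A^{2U} ≤ U^U` once `U ≥ A²`, and `c⁺ U^{U+4} ≤ exp(4εU²)` by `quantClip_powSelf_le_exp`). -/
theorem const_le_exp {ε : ℝ} (hε : 0 < ε) (c : ℝ) {A : ℝ} (hA : 1 ≤ A) :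
    ∃ U₀ : ℕ, ∀ U : ℕ, U₀ ≤ U → c * A ^ (2 * U) * (U : ℝ) ^ 4 ≤ Real.exp (4 * ε * (U : ℝ) ^ 2) := by
  obtain ⟨U₁, hU₁⟩ := quantClip_powSelf_le_exp (δ := 4 * ε) (by positivity) 4 (max c 0)
  refine ⟨max U₁ ⌈A ^ 2⌉₊, fun U hU => ?_⟩
  have hU₁U : U₁ ≤ U := le_of_max_le_left hU
  have hAU : A ^ 2 ≤ U := le_trans (Nat.le_ceil _) (by exact_mod_cast le_of_max_le_right hU)
  have hA0 : 0 ≤ A := by linarith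
  have hc0 : 0 ≤ max c 0 := le_max_right _ _
  have h1 : A ^ (2 * U) ≤ (U : ℝ) ^ U := by
    rw [pow_mul]; exact pow_le_pow_left₀ (by positivity) hAU U
  calc c * A ^ (2 * U) * (U : ℝ) ^ 4 ≤ max c 0 * A ^ (2 * U) * (U : ℝ) ^ 4 :=
        mul_le_mul_of_nonneg_right (mul_le_mul_of_nonneg_right (le_max_left _ _) (by positivity))
          (by positivity)
    _ ≤ max c 0 * (U : ℝ) ^ U * (U : ℝ) ^ 4 :=
        mul_le_mul_of_nonneg_right (mul_le_mul_of_nonneg_left h1 hc0) (by positivity)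
    _ = max c 0 * (U : ℝ) ^ (U + 4) := by rw [pow_add]; ring
    _ ≤ Real.exp (4 * ε * (U : ℝ) ^ 2) := hU₁ U hU₁U

/-- **Schedule thresholds.** For `U ≥ 8`, `L + 18t + 3 ≤ U`, `2L ≤ U`, `N ≥ 16`, `exp(4U²) ≤ log N` and
`log log N ≤ (2U+2)²`: `1 + 4U² + 4U⁴ ≤ log N` (`exp(4U²) = exp(2U²)² ≥ (1 + 2U²)²`), hence
`L + 18t + 50U + 3 ≤ log N` (`51U ≤ 4U⁴`), `U log(2L) ≤ log N` (`log(2L) ≤ 2L ≤ U`) and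
`log² N ≤ N^{1/U}` (`2U log log N ≤ 2U(2U+2)² ≤ 4U⁴ ≤ log N`). -/
theorem thresholds {t L U N : ℕ} (hU8 : 8 ≤ U) (hMU : L + 18 * t + 3 ≤ U) (hLU : 2 * L ≤ U)
    (hN16 : 16 ≤ N) (hexp : Real.exp (4 * (U : ℝ) ^ 2) ≤ Real.log N)
    (hll : Real.log (Real.log N) ≤ (2 * (U : ℝ) + 2) ^ 2) :
    1 + 4 * (U : ℝ) ^ 2 + 4 * (U : ℝ) ^ 4 ≤ Real.log N ∧
    (L : ℝ) + 18 * t + 50 * U + 3 ≤ Real.log N ∧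
    (U : ℝ) * Real.log (2 * L) ≤ Real.log N ∧
    Real.log N ^ 2 ≤ zOf N U := by
  have hU8r : (8 : ℝ) ≤ U := by exact_mod_cast hU8
  have hMUr : (L : ℝ) + 18 * t + 3 ≤ U := by exact_mod_cast hMU
  have hLUr : 2 * (L : ℝ) ≤ U := by exact_mod_cast hLU
  have hN0 : (0 : ℝ) < N := by exact_mod_cast (show 0 < N by omega)
  have hUpos : (0 : ℝ) < U := by linarith
  -- `1 + 4U² + 4U⁴ ≤ log N`
  have hlog : 1 + 4 * (U : ℝ) ^ 2 + 4 * (U : ℝ) ^ 4 ≤ Real.log N := by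
    have h1 : 2 * (U : ℝ) ^ 2 + 1 ≤ Real.exp (2 * (U : ℝ) ^ 2) := Real.add_one_le_exp _
    calc 1 + 4 * (U : ℝ) ^ 2 + 4 * (U : ℝ) ^ 4 = (2 * (U : ℝ) ^ 2 + 1) ^ 2 := by ring
      _ ≤ Real.exp (2 * (U : ℝ) ^ 2) ^ 2 := pow_le_pow_left₀ (by positivity) h1 2
      _ = Real.exp (4 * (U : ℝ) ^ 2) := by rw [sq, ← Real.exp_add]; ring_nf
      _ ≤ Real.log N := hexp
  have hU3 : (512 : ℝ) ≤ (U : ℝ) ^ 3 :=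
    le_trans (by norm_num) (pow_le_pow_left₀ (by norm_num) hU8r 3)
  have hU4 : (U : ℝ) ^ 4 = U * (U : ℝ) ^ 3 := by ring
  have h51 : 51 * (U : ℝ) ≤ 4 * (U : ℝ) ^ 4 := by
    rw [hU4]; nlinarith [mul_le_mul_of_nonneg_left hU3 hUpos.le]
  have hℓ4 : 4 * (U : ℝ) ^ 4 ≤ Real.log N := by
    have h0 : (0 : ℝ) ≤ 4 * (U : ℝ) ^ 2 := by positivity
    linarith
  have hℓpos : 0 < Real.log N := by nlinarith
  refine ⟨hlog, by linarith, ?_, ?_⟩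
  · -- `U log(2L) ≤ U · U ≤ log N`
    have hlg : Real.log (2 * L) ≤ 2 * L := Real.log_le_self (by positivity)
    calc (U : ℝ) * Real.log (2 * L) ≤ U * U :=
          mul_le_mul_of_nonneg_left (hlg.trans hLUr) hUpos.le
      _ = (U : ℝ) ^ 2 := by ring
      _ ≤ Real.log N := by nlinarith
  · -- `log² N ≤ N^{1/U}`
    have hkey : 2 * (U : ℝ) * Real.log (Real.log N) ≤ Real.log N := by
      have h5 : (2 * (U : ℝ) + 2) ^ 2 ≤ 9 * (U : ℝ) ^ 2 := by nlinarith
      have h6 : 2 * (U : ℝ) * (9 * (U : ℝ) ^ 2) ≤ 4 * (U : ℝ) ^ 4 := by rw [hU4]; nlinarith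
      have h7 : 2 * (U : ℝ) * Real.log (Real.log N) ≤ 2 * U * (9 * (U : ℝ) ^ 2) :=
        mul_le_mul_of_nonneg_left (hll.trans h5) (by positivity)
      linarith
    have h8 : Real.log N ^ 2 = Real.exp (2 * Real.log (Real.log N)) := by
      rw [show (2 : ℝ) * Real.log (Real.log N) = Real.log (Real.log N) + Real.log (Real.log N) by ring,
        Real.exp_add, Real.exp_log hℓpos, sq]
    rw [zOf, Real.rpow_def_of_pos hN0, h8, Real.exp_le_exp,
      show Real.log N * (1 / (U : ℝ)) = Real.log N / U by ring, le_div_iff₀ hUpos]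
    linarith

/-- **Bookkeeping of the constants.** With `V ≥ 1`, `P ≥ 1`, `C₁, t, lg ≥ 0`, `c₀ = C₁ + 32t + 51`,
`C₁' = V (C₁ + 32t + 50V)`, `C₂ = 3PV²`, `K = (C₂ + 1) lg (V + C₁') + C₁' + C₂` and
`c = 8 c₀ lg + 3 c₀ + 6`: `V + C₁' ≤ c P V⁴` and `2K ≤ c P V⁴`. -/
theorem bookkeeping {V P C₁ t lg : ℝ} (hV : 1 ≤ V) (hP : 1 ≤ P) (hC₁ : 0 ≤ C₁) (ht : 0 ≤ t)
    (hlg : 0 ≤ lg) :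
    V + V * (C₁ + 32 * t + 50 * V) ≤
        (8 * (C₁ + 32 * t + 51) * lg + 3 * (C₁ + 32 * t + 51) + 6) * P * V ^ 4 ∧
      2 * ((3 * P * V ^ 2 + 1) * lg * (V + V * (C₁ + 32 * t + 50 * V)) +
            V * (C₁ + 32 * t + 50 * V) + 3 * P * V ^ 2) ≤
        (8 * (C₁ + 32 * t + 51) * lg + 3 * (C₁ + 32 * t + 51) + 6) * P * V ^ 4 := by
  set c₀ : ℝ := C₁ + 32 * t + 51 with hc₀
  have hc₀0 : 0 ≤ c₀ := by rw [hc₀]; positivity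
  have hV0 : 0 ≤ V := by linarith
  have hV2 : 1 ≤ V ^ 2 := one_le_pow₀ hV
  have hVV : V ≤ V ^ 2 := by nlinarith
  have hPV2 : 1 ≤ P * V ^ 2 := one_le_mul_of_one_le_of_one_le hP hV2
  have hV24 : V ^ 2 ≤ P * V ^ 4 :=
    calc V ^ 2 = V ^ 2 * 1 := by ring
      _ ≤ V ^ 2 * (P * V ^ 2) := mul_le_mul_of_nonneg_left hPV2 (by positivity)
      _ = P * V ^ 4 := by ring
  have hPV4 : 0 ≤ P * V ^ 4 := by nlinarith
  have hB : V + V * (C₁ + 32 * t + 50 * V) ≤ c₀ * V ^ 2 := by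
    rw [hc₀]
    nlinarith [mul_nonneg hC₁ (sub_nonneg.2 hVV), mul_nonneg ht (sub_nonneg.2 hVV)]
  have hB0 : 0 ≤ V + V * (C₁ + 32 * t + 50 * V) := by positivity
  have hBc : V + V * (C₁ + 32 * t + 50 * V) ≤ c₀ * (P * V ^ 4) :=
    hB.trans (mul_le_mul_of_nonneg_left hV24 hc₀0)
  have hclg : 0 ≤ c₀ * lg * (P * V ^ 4) := by positivity
  constructor
  · nlinarith [mul_nonneg hc₀0 hPV4]
  · have hC₂1 : 3 * P * V ^ 2 + 1 ≤ 4 * P * V ^ 2 := by linarith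
    have h1 : (3 * P * V ^ 2 + 1) * lg * (V + V * (C₁ + 32 * t + 50 * V)) ≤
        4 * P * V ^ 2 * lg * (c₀ * V ^ 2) :=
      mul_le_mul (mul_le_mul_of_nonneg_right hC₂1 hlg) hB hB0 (by positivity)
    have h2 : V * (C₁ + 32 * t + 50 * V) ≤ c₀ * (P * V ^ 4) := le_trans (by linarith) hBc
    have h3 : P * V ^ 2 ≤ P * V ^ 4 :=
      mul_le_mul_of_nonneg_left (by nlinarith) (by linarith)
    nlinarith [mul_nonneg hc₀0 hPV4]

end MainTermAlongAux

open MainTermAlongAux GeThreeMainTermAux in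
/-- **`stub_mainTermAlong`** (registered stub of the line `superpoly-band-same-atom`, skeleton v2):
`SectionMertensLowerHead → MainTermConversionAlong`. For `ε > 0` the threshold is
`N₀ = max N₁ N₂`, `N₁` the lower-head threshold and `N₂` that of `quantClip_schedule` at
`U₀ = max (max 8 (L + 18t + 3)) (max 2L U₁)`, `U₁ = U₁(ε, c, A)` from `const_le_exp` with
`c = 8 c₀ log(2L) + 3 c₀ + 6`, `c₀ = C₁ + 32t + 51`. -/
theorem stub_mainTermAlong : MainTermAlong := by
  intro hLH t L ε hε
  obtain ⟨C₁, hC₁, N₁, hN₁⟩ := hLH t L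
  obtain ⟨A, hA2, hAl⟩ := alladi_along
  have hA1 : (1 : ℝ) ≤ A := by linarith
  have ht0 : (0 : ℝ) ≤ t := Nat.cast_nonneg t
  have hlg : 0 ≤ Real.log (2 * L) := by
    have h : Real.log (2 * L) = Real.log ((2 * L : ℕ) : ℝ) := by push_cast; rfl
    rw [h]; exact Real.log_natCast_nonneg _
  obtain ⟨U₁, hU₁⟩ := const_le_exp hε
    (8 * (C₁ + 32 * t + 51) * Real.log (2 * L) + 3 * (C₁ + 32 * t + 51) + 6) hA1
  obtain ⟨N₂, hN₂⟩ := quantClip_schedule (max (max 8 (L + 18 * t + 3)) (max (2 * L) U₁))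
  refine ⟨max N₁ N₂, fun N hN Ψ hΨ hL i hg1 hne => ?_⟩
  obtain ⟨hU₀U, hN16, hexp, hll⟩ := hN₂ N (le_of_max_le_right hN)
  have hNN₁ : N₁ ≤ N := le_of_max_le_left hN
  set U : ℕ := slowDegree N with hUdef
  have hU8 : 8 ≤ U := le_of_max_le_left (le_of_max_le_left hU₀U)
  have hMU : L + 18 * t + 3 ≤ U := le_of_max_le_right (le_of_max_le_left hU₀U)
  have hLU : 2 * L ≤ U := le_of_max_le_left (le_of_max_le_right hU₀U)
  have hU₁U : U₁ ≤ U := le_of_max_le_right (le_of_max_le_right hU₀U)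
  have hU4 : 4 ≤ U := by omega
  have hU1 : 1 ≤ U := by omega
  have hU1r : (1 : ℝ) ≤ U := by exact_mod_cast hU1
  have hU2r : (2 : ℝ) ≤ U := by exact_mod_cast (show 2 ≤ U by omega)
  obtain ⟨hlog, hAN, hUlg, hsq⟩ := thresholds hU8 hMU hLU hN16 hexp hll
  have hℓ1 : 1 ≤ Real.log N := by nlinarith
  have hℓ0 : 0 < Real.log N := by linarith
  have hU2ℓ : (U : ℝ) ^ 2 ≤ Real.log N := by nlinarith
  have hH : 0 ≤ sectionH Ψ i := MertensAux.sectionH_nonneg Ψ hΨ i hne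
  have hL1 : 1 ≤ L := by exact_mod_cast (one_le_of_affLinSize_le Ψ hΨ hL i : (1 : ℝ) ≤ L)
  have hcε : (8 * (C₁ + 32 * t + 51) * Real.log (2 * L) + 3 * (C₁ + 32 * t + 51) + 6) *
      A ^ (2 * U) * (U : ℝ) ^ 4 ≤ Real.log N ^ ε := by
    refine (hU₁ U hU₁U).trans ?_
    rw [show 4 * ε * (U : ℝ) ^ 2 = 4 * (U : ℝ) ^ 2 * ε by ring, Real.exp_mul]
    exact Real.rpow_le_rpow (Real.exp_pos _).le hexp hε.le
  obtain ⟨hBc, h2Kc⟩ := bookkeeping (P := A ^ (2 * U)) (lg := Real.log (2 * L)) hU1r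
    (one_le_pow₀ hA1) hC₁ ht0 hlg
  have hG := mertensTwo_explicit hC₁ hN₁ hU1 hNN₁ hAN hsq (by omega) Ψ hΨ hL i hg1 hne
  set C₁' : ℝ := (U : ℝ) * (C₁ + 32 * t + 50 * U) with hC₁'
  have hC₁'0 : 0 ≤ C₁' := by positivity
  have hGabs := abs_main_le hℓ1 (Nat.cast_nonneg U) hH hC₁'0 hG
  refine ⟨?_, fun δ' hδ0 hδ2 m hm F' hF' => ?_⟩
  · -- clause (a): `G ≤ |G| ≤ (U + C₁') H/ℓ ≤ (log N)^ε H/ℓ`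
    calc Real.exp Real.eulerMascheroniConstant *
          ∏ p ∈ Nat.primesBelow ⌈zOf N U⌉₊, (1 - sectionDensity Ψ i p)
        ≤ ((U : ℝ) + C₁') * sectionH Ψ i / Real.log N := (le_abs_self _).trans hGabs
      _ ≤ Real.log N ^ ε * sectionH Ψ i / Real.log N :=
          div_le_div_of_nonneg_right (mul_le_mul_of_nonneg_right (hBc.trans hcε) hH) hℓ0.le
      _ = sectionH Ψ i * Real.log N ^ ε / Real.log N := by ring
  · -- clause (b): the sister's four-term bound with `u := U`, `C₂ := 3 A^{2U} U²`
    rw [log_ratio_eq hL1 (by omega) hU1]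
    set e : ℝ := (U : ℝ) * Real.log (2 * L) / Real.log N with he
    have he0 : 0 ≤ e := by positivity
    set C₂ : ℝ := 3 * A ^ (2 * U) * (U : ℝ) ^ 2 with hC₂
    have hC₂1 : 1 ≤ C₂ := by
      have h := one_le_mul_of_one_le_of_one_le (one_le_pow₀ hA1 : 1 ≤ A ^ (2 * U))
        (one_le_pow₀ hU1r : (1 : ℝ) ≤ U ^ 2)
      rw [hC₂]; linarith
    have hI : |roughCellDensity m ((U : ℝ) + e) - roughCellDensity m U| ≤ C₂ * e := by
      have h := ModelDensityAlladiAux.abs_sub_le hm hU1r (show (U : ℝ) ≤ U + e by linarith)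
      rw [add_sub_cancel_left] at h
      exact h.trans (le_mul_of_one_le_left he0 hC₂1)
    have ha : |modelDensity N U m - roughCellDensity m U / Real.log N| ≤ C₂ / Real.log N ^ 2 :=
      hAl hU4 hN16 hU2ℓ hm
    have hcore := core_bound hℓ1 hU2r hH hC₁'0 (by linarith : (0 : ℝ) ≤ C₂) hlg hG he hI
      (roughCellDensity_nonneg m U) (roughCellDensity_le hm hU1r) ha
    have hw := WalshStepAux.abs_parityWeight_le hδ0 hδ2 m
    set G := Real.exp Real.eulerMascheroniConstant *
      ∏ p ∈ Nat.primesBelow ⌈zOf N U⌉₊, (1 - sectionDensity Ψ i p) with hGdef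
    set w := 1 + (δ' - 1) * (-1 : ℝ) ^ m with hwdef
    set K := (C₂ + 1) * Real.log (2 * L) * (U + C₁') + C₁' + C₂ with hKdef
    calc |w * (roughCellDensity m (U + e) / (U + e)) * G * F' -
            w * modelDensity N U m * sectionH Ψ i * F'|
          = |w| * |roughCellDensity m (U + e) / (U + e) * G - modelDensity N U m * sectionH Ψ i| *
              F' := by
          rw [← sub_mul, mul_assoc, mul_assoc w, ← mul_sub, abs_mul, abs_mul, abs_of_nonneg hF']
      _ ≤ 2 * (K * sectionH Ψ i / Real.log N ^ 2) * F' :=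
          mul_le_mul_of_nonneg_right (mul_le_mul hw hcore (abs_nonneg _) zero_le_two) hF'
      _ = 2 * K * (sectionH Ψ i * F' / Real.log N ^ 2) := by ring
      _ ≤ Real.log N ^ ε * (sectionH Ψ i * F' / Real.log N ^ 2) :=
          mul_le_mul_of_nonneg_right (h2Kc.trans hcε) (by positivity)
      _ = sectionH Ψ i * F' * Real.log N ^ ε / Real.log N ^ 2 := by ring

end Summit.Parity.GeneralizedHardyLittlewood.Cruxes.CellParityLawSaving.SuperPolyBand

end
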